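import Summits.AtomisticToContinuum.HydrodynamicLimit.Theorems.OneSphereInfluenceMeanVarianceL2Analysis
import Summits.AtomisticToContinuum.HydrodynamicLimit.Theorems.OneSphereInfluenceMeanVarianceL2Score
import Summits.AtomisticToContinuum.HydrodynamicLimit.Theorems.OneSphereInfluenceMeanVarianceL2Fields
import HarnessLib

/-!
# Glue `MeanVarianceL2` of route `OneSphereInfluence`, part 4: one observable along the homotopy

Support file (`--supports stmt-AtomisticToContinuum-13622`) for the support item `MeanVarianceL2`
(`Summit.AtomisticToContinuum.HydrodynamicLimit.Theses.OneSphereInfluence.MeanVarianceL2`).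

`tendsto_lintegral_sq_observable`: the mean–variance argument for ONE scalar observable
`F_N(Φ_t z)` of quadratic velocity growth along a smooth positive profile path `κ ∈ [0,1]` with
constant start:

* mean: the score identity (part 2) for the good-set modification of `F_N ∘ Φ_t` (energy
  conservation makes the velocity-growth bound a bound in the INITIAL velocities), the uniform
  convergence of the covariances (hypothesis `hunif` = `ScoreLinearResponse`), the fundamental
  theorem of calculus on both sides (part 1), and the anchor at `κ = 0`: invariance of the
  homogeneous law (`hinv` = `HomogeneousInvariance`), `Φ_0 = id` a.e., convergence in probability
  at time `0` (`h0` = the `κ = 0` local-Gibbs LLN hypothesis) upgraded to convergence of means by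
  the uniform fourth-moment bound (`hmom`, part 3);
* variance: `Var ≤ C·V_N → 0` (hypotheses `hvarle`, `hV` = `HardCorePoincare` ×
  `ResamplingInfluence`), `L²` membership from the Gaussian domination of part 2;
* conclusion by the abstract mean–variance theorem of part 1.
-/

noncomputable section

open MeasureTheory ProbabilityTheory Filter Set Topology
open scoped ENNReal InnerProductSpace

namespace Summit.AtomisticToContinuum.HydrodynamicLimit.Theorems.OneSphereInfluenceMeanVarianceL2

open Literature.MathematicalPhysics.KineticTheory Literature.Analysis.FluidPDE
open Literature.Analysis.FunctionSpaces

/-- The covariance only depends on the a.e. class of its second argument. [folklore] -/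
theorem covariance_congr_ae_right {Ω : Type*} [MeasurableSpace Ω] {μ : Measure Ω} {X Y Y' : Ω → ℝ}
    (h : Y =ᵐ[μ] Y') : covariance X Y μ = covariance X Y' μ := by
  simp only [covariance]
  have hm : μ[Y] = μ[Y'] := integral_congr_ae h
  refine integral_congr_ae ?_
  filter_upwards [h] with ω hω
  rw [hω, hm]

/-- `L²` membership under a local Gibbs law of a measurable observable of quadratic velocity
growth (Gaussian domination of the log-profile). [folklore] -/
theorem memLp_two_localGibbsLaw_of_le {σ : ℝ} {N : ℕ}
    (Φ : HardSphereFlow (Torus.geometry (Fin 3)) (hsDiameter σ N) (N + 1)) {a₀ θ₀ : T3 → ℝ}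
    {u₀ : T3 → V3} (ha : Continuous a₀) (hθ : Continuous θ₀) (hu : Continuous u₀)
    (ha0 : ∀ x, 0 < a₀ x) (hθ0 : ∀ x, 0 < θ₀ x) {C₂ b K : ℝ} (hb : 0 < b)
    (hψle : ∀ y, Real.log (localGibbsProfile a₀ u₀ θ₀ y) ≤ C₂ - b * ‖y.2‖ ^ 2)
    {G : Config (N + 1) (Fin 3) T3 → ℝ} (hGm : Measurable G)
    (hG : ∀ z, |G z| ≤ K * (1 + ∑ k, ‖(z k).2‖ ^ 2)) :
    MemLp G 2 (localGibbsLaw σ a₀ u₀ θ₀ N Φ) := by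
  refine (memLp_two_iff_integrable_sq hGm.aestronglyMeasurable).2 ?_
  refine integrable_localGibbsLaw_of_sq Φ ha hθ hu ha0 hθ0 (sq_nonneg K) hb hψle (hGm.pow_const 2)
    fun z => ?_
  rw [abs_of_nonneg (sq_nonneg _), ← sq_abs, ← mul_pow]
  exact pow_le_pow_left₀ (abs_nonneg _) (hG z) 2

/-- **One observable along the homotopy.** See the module docstring. [folklore] -/
theorem tendsto_lintegral_sq_observable
    {σ : ℝ} (hσ2 : σ ≤ 1 / 2) {a θ₀ : ℝ → T3 → ℝ} {u₀ : ℝ → T3 → V3}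
    (ha : Torus.IsSmoothSpaceTimeOn (Icc 0 1) a) (hθ : Torus.IsSmoothSpaceTimeOn (Icc 0 1) θ₀)
    (hu : Torus.IsSmoothSpaceTimeOn (Icc 0 1) u₀) (ha0 : ∀ s ∈ Icc (0 : ℝ) 1, ∀ x, 0 < a s x)
    (hθ0 : ∀ s ∈ Icc (0 : ℝ) 1, ∀ x, 0 < θ₀ s x)
    (Φ : (N : ℕ) → HardSphereFlow (Torus.geometry (Fin 3)) (hsDiameter σ N) (N + 1)) {t : ℝ}
    (hinv : ∀ N, (Φ N).lawAt (localGibbsLaw σ (a 0) (u₀ 0) (θ₀ 0) N (Φ N)) t =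
      localGibbsLaw σ (a 0) (u₀ 0) (θ₀ 0) N (Φ N))
    {M₄ : ℝ≥0∞} (hM₄ : M₄ ≠ ∞)
    (hmom : ∀ N, ∫⁻ z, ENNReal.ofReal (((N + 1 : ℕ) : ℝ)⁻¹ * ∑ k, ‖(z k).2‖ ^ 4)
      ∂(localGibbsLaw σ (a 0) (u₀ 0) (θ₀ 0) N (Φ N)) ≤ M₄)
    {F : (N : ℕ) → Config (N + 1) (Fin 3) T3 → ℝ} (hFm : ∀ N, Measurable (F N)) {K : ℝ}
    (hK : 0 ≤ K) (hFbd : ∀ N w, |F N w| ≤ K * (1 + ∑ k, ‖(w k).2‖ ^ 2))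
    (hFsq : ∀ N z, (F N z) ^ 2 ≤ K ^ 2 * (1 + ((N + 1 : ℕ) : ℝ)⁻¹ * ∑ k, ‖(z k).2‖ ^ 4))
    {c : ℝ → ℝ} (hc : ∀ κ ∈ Icc (0 : ℝ) 1, DifferentiableWithinAt ℝ c (Icc 0 1) κ) {c₀ : ℝ}
    (hc0 : c 0 = c₀)
    (h0 : ∀ δ : ℝ, 0 < δ → Tendsto (fun N => localGibbsLaw σ (a 0) (u₀ 0) (θ₀ 0) N (Φ N)
      {z | δ < |F N ((Φ N).flow 0 z) - c₀|}) atTop (𝓝 0))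
    (hunif : TendstoUniformlyOn (fun N κ => covariance (fun z => ∑ i, derivWithin
        (fun κ' => Real.log (localGibbsProfile (a κ') (u₀ κ') (θ₀ κ') (z i))) (Icc 0 1) κ)
        (fun z => F N ((Φ N).flow t z)) (localGibbsLaw σ (a κ) (u₀ κ) (θ₀ κ) N (Φ N)))
      (fun κ => derivWithin c (Icc 0 1) κ) atTop (Icc 0 1))
    {V : ℕ → ℝ} {C : ℝ}
    (hvarle : ∀ N, MemLp (fun z => F N ((Φ N).flow t z)) 2 (localGibbsLaw σ (a 1) (u₀ 1) (θ₀ 1) N (Φ N)) →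
      variance (fun z => F N ((Φ N).flow t z)) (localGibbsLaw σ (a 1) (u₀ 1) (θ₀ 1) N (Φ N)) ≤ C * V N)
    (hV : Tendsto V atTop (𝓝 0)) :
    Tendsto (fun N => ∫⁻ z, ENNReal.ofReal ((F N ((Φ N).flow t z) - c 1) ^ 2)
      ∂(localGibbsLaw σ (a 1) (u₀ 1) (θ₀ 1) N (Φ N))) atTop (𝓝 0) := by
  have h01 : (0 : ℝ) ∈ Icc (0 : ℝ) 1 := ⟨le_rfl, zero_le_one⟩
  have h11 : (1 : ℝ) ∈ Icc (0 : ℝ) 1 := ⟨zero_le_one, le_rfl⟩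
  have hac : ∀ s ∈ Icc (0 : ℝ) 1, Continuous (a s) := fun s hs => (ha.isSmooth_slice hs).continuous
  have hθc : ∀ s ∈ Icc (0 : ℝ) 1, Continuous (θ₀ s) := fun s hs => (hθ.isSmooth_slice hs).continuous
  have huc : ∀ s ∈ Icc (0 : ℝ) 1, Continuous (u₀ s) := fun s hs => (hu.isSmooth_slice hs).continuous
  obtain ⟨C₂, b, hb, hψle⟩ := exists_log_localGibbsProfile_le ha hθ hu ha0 hθ0
  -- the laws along the path
  set p : ℝ → (N : ℕ) → Measure (Config (N + 1) (Fin 3) T3) :=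
    fun κ N => localGibbsLaw σ (a κ) (u₀ κ) (θ₀ κ) N (Φ N) with hp
  have hprob : ∀ κ ∈ Icc (0 : ℝ) 1, ∀ N, IsProbabilityMeasure (p κ N) := fun κ hκ N =>
    isProbabilityMeasure_localGibbsLaw (hac κ hκ) (hθc κ hκ) (huc κ hκ) (ha0 κ hκ) (hθ0 κ hκ) hσ2 N (Φ N)
  -- the good-set modification of the transported observable
  set G : (N : ℕ) → Config (N + 1) (Fin 3) T3 → ℝ :=
    fun N z => (Φ N).good.indicator (fun z => F N ((Φ N).flow t z)) z with hG
  have hFtm : ∀ N, Measurable fun z => F N ((Φ N).flow t z) := fun N =>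
    (hFm N).comp ((Φ N).measurable_flow t)
  have hGm : ∀ N, Measurable (G N) := fun N => (hFtm N).indicator (Φ N).measurableSet_good
  have hGbd : ∀ N z, |G N z| ≤ K * (1 + ∑ k, ‖(z k).2‖ ^ 2) := by
    intro N z
    by_cases hz : z ∈ (Φ N).good
    · simp only [hG, Set.indicator_of_mem hz]
      rw [← sum_sq_norm_flow (Φ N) hz t]
      exact hFbd N _
    · simp only [hG, Set.indicator_of_notMem hz, abs_zero]
      exact mul_nonneg hK (by have := sum_sq_norm_nonneg z; positivity)
  have hGae : ∀ κ N, G N =ᵐ[p κ N] fun z => F N ((Φ N).flow t z) := fun κ N =>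
    indicator_good_ae_eq (Φ N) _
  -- `L²` membership along the path
  have hGmem : ∀ κ ∈ Icc (0 : ℝ) 1, ∀ N, MemLp (G N) 2 (p κ N) := fun κ hκ N =>
    memLp_two_localGibbsLaw_of_le (Φ N) (hac κ hκ) (hθc κ hκ) (huc κ hκ) (ha0 κ hκ) (hθ0 κ hκ) hb
      (hψle κ hκ) (hGm N) (hGbd N)
  have hFmem : ∀ κ ∈ Icc (0 : ℝ) 1, ∀ N, MemLp (fun z => F N ((Φ N).flow t z)) 2 (p κ N) :=
    fun κ hκ N => (hGmem κ hκ N).ae_eq (hGae κ N)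
  -- the score identity for `G N`
  have hscore := fun N =>
    hasDerivWithinAt_integral_localGibbsLaw hσ2 (Φ N) ha hθ hu ha0 hθ0 (hGm N) hK (hGbd N)
  have hEG : ∀ κ N, ∫ z, G N z ∂(p κ N) = ∫ z, F N ((Φ N).flow t z) ∂(p κ N) := fun κ N =>
    integral_congr_ae (hGae κ N)
  have hcovG : ∀ κ N, covariance (fun z => ∑ i, derivWithin
      (fun κ' => Real.log (localGibbsProfile (a κ') (u₀ κ') (θ₀ κ') (z i))) (Icc 0 1) κ) (G N) (p κ N) =
      covariance (fun z => ∑ i, derivWithin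
        (fun κ' => Real.log (localGibbsProfile (a κ') (u₀ κ') (θ₀ κ') (z i))) (Icc 0 1) κ)
        (fun z => F N ((Φ N).flow t z)) (p κ N) := fun κ N => covariance_congr_ae_right (hGae κ N)
  -- (1)–(2) derivative identity and continuity of the derivatives
  have hderiv : ∀ᶠ N in atTop, ∀ κ ∈ Icc (0 : ℝ) 1, HasDerivWithinAt
      (fun κ => ∫ z, F N ((Φ N).flow t z) ∂(p κ N))
      (covariance (fun z => ∑ i, derivWithin
        (fun κ' => Real.log (localGibbsProfile (a κ') (u₀ κ') (θ₀ κ') (z i))) (Icc 0 1) κ) (G N) (p κ N))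
      (Icc 0 1) κ :=
    Eventually.of_forall fun N κ hκ =>
      ((hscore N).1 κ hκ).congr_of_mem (fun κ' _ => (hEG κ' N).symm) hκ
  have hcont : ∀ᶠ N in atTop, ContinuousOn (fun κ => covariance (fun z => ∑ i, derivWithin
      (fun κ' => Real.log (localGibbsProfile (a κ') (u₀ κ') (θ₀ κ') (z i))) (Icc 0 1) κ) (G N) (p κ N))
      (Icc 0 1) :=
    Eventually.of_forall fun N => (hscore N).2
  -- (3) uniform convergence of the covariances, transferred to `G N`
  have hunif' : TendstoUniformlyOn (fun N κ => covariance (fun z => ∑ i, derivWithin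
      (fun κ' => Real.log (localGibbsProfile (a κ') (u₀ κ') (θ₀ κ') (z i))) (Icc 0 1) κ) (G N) (p κ N))
      (fun κ => derivWithin c (Icc 0 1) κ) atTop (Icc 0 1) :=
    hunif.congr (Eventually.of_forall fun N κ _ => (hcovG κ N).symm)
  -- (4) the anchor at `κ = 0`
  have hanchor : Tendsto (fun N => ∫ z, F N ((Φ N).flow t z) ∂(p 0 N)) atTop (𝓝 (c 0)) := by
    haveI : ∀ N, IsProbabilityMeasure (p 0 N) := hprob 0 h01
    -- reduce time `t` to time `0`
    have hred : ∀ N, ∫ z, F N ((Φ N).flow t z) ∂(p 0 N) = ∫ z, F N ((Φ N).flow 0 z) ∂(p 0 N) := by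
      intro N
      rw [integral_comp_flow_of_lawAt_eq (Φ N) (hinv N) (hFm N)]
      exact (integral_congr_ae (comp_flow_zero_ae_eq (Φ N) (F N))).symm
    simp_rw [hred]
    -- the deviation at time `0`
    have hXm : ∀ N, Measurable fun z => F N ((Φ N).flow 0 z) - c₀ := fun N =>
      ((hFm N).comp ((Φ N).measurable_flow 0)).sub measurable_const
    have hF0mem : ∀ N, MemLp (F N) 2 (p 0 N) := fun N =>
      memLp_two_localGibbsLaw_of_le (Φ N) (hac 0 h01) (hθc 0 h01) (huc 0 h01) (ha0 0 h01) (hθ0 0 h01)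
        hb (hψle 0 h01) (hFm N) (hFbd N)
    have hF00mem : ∀ N, MemLp (fun z => F N ((Φ N).flow 0 z)) 2 (p 0 N) := fun N =>
      (hF0mem N).ae_eq (comp_flow_zero_ae_eq (Φ N) (F N)).symm
    have hXmem : ∀ N, MemLp (fun z => F N ((Φ N).flow 0 z) - c₀) 2 (p 0 N) := fun N =>
      (hF00mem N).sub (memLp_const c₀)
    have hX2 : ∀ N, Integrable (fun z => (F N ((Φ N).flow 0 z) - c₀) ^ 2) (p 0 N) := fun N =>
      (hXmem N).integrable_sq
    -- the uniform second-moment bound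
    have h4m : ∀ N, Measurable fun z : Config (N + 1) (Fin 3) T3 =>
        ((N + 1 : ℕ) : ℝ)⁻¹ * ∑ k, ‖(z k).2‖ ^ 4 := fun N =>
      measurable_const.mul (Finset.measurable_sum _ fun k _ => ((measurable_pi_apply k).snd.norm).pow_const 4)
    have h4nn : ∀ N (z : Config (N + 1) (Fin 3) T3), 0 ≤ ((N + 1 : ℕ) : ℝ)⁻¹ * ∑ k, ‖(z k).2‖ ^ 4 :=
      fun N z => mul_nonneg (inv_nonneg.2 (by positivity)) (Finset.sum_nonneg fun _ _ => by positivity)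
    have h4int : ∀ N, Integrable (fun z : Config (N + 1) (Fin 3) T3 =>
        ((N + 1 : ℕ) : ℝ)⁻¹ * ∑ k, ‖(z k).2‖ ^ 4) (p 0 N) := fun N =>
      ⟨(h4m N).aestronglyMeasurable, (hasFiniteIntegral_iff_ofReal (ae_of_all _ (h4nn N))).2
        ((hmom N).trans_lt hM₄.lt_top)⟩
    have h4le : ∀ N, ∫ z, ((N + 1 : ℕ) : ℝ)⁻¹ * ∑ k, ‖(z k).2‖ ^ 4 ∂(p 0 N) ≤ M₄.toReal := by
      intro N
      rw [integral_eq_lintegral_of_nonneg_ae (ae_of_all _ (h4nn N)) (h4m N).aestronglyMeasurable]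
      exact ENNReal.toReal_mono hM₄ (hmom N)
    have hF2le : ∀ N, ∫ z, (F N z) ^ 2 ∂(p 0 N) ≤ K ^ 2 * (1 + M₄.toReal) := by
      intro N
      calc ∫ z, (F N z) ^ 2 ∂(p 0 N)
          ≤ ∫ z, K ^ 2 * (1 + ((N + 1 : ℕ) : ℝ)⁻¹ * ∑ k, ‖(z k).2‖ ^ 4) ∂(p 0 N) :=
            integral_mono (hF0mem N).integrable_sq (((integrable_const _).add (h4int N)).const_mul _)
              (hFsq N)
        _ = K ^ 2 * (1 + ∫ z, ((N + 1 : ℕ) : ℝ)⁻¹ * ∑ k, ‖(z k).2‖ ^ 4 ∂(p 0 N)) := by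
            rw [integral_const_mul, integral_add (integrable_const _) (h4int N), integral_const]
            simp
        _ ≤ K ^ 2 * (1 + M₄.toReal) :=
            mul_le_mul_of_nonneg_left (add_le_add le_rfl (h4le N)) (sq_nonneg _)
    have hB : ∀ N, ∫ z, (F N ((Φ N).flow 0 z) - c₀) ^ 2 ∂(p 0 N) ≤
        2 * (K ^ 2 * (1 + M₄.toReal)) + 2 * c₀ ^ 2 := by
      intro N
      have hpt : ∀ z, (F N ((Φ N).flow 0 z) - c₀) ^ 2 ≤ 2 * (F N ((Φ N).flow 0 z)) ^ 2 + 2 * c₀ ^ 2 :=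
        fun z => by nlinarith [sq_nonneg (F N ((Φ N).flow 0 z) + c₀)]
      have hF002 : ∫ z, (F N ((Φ N).flow 0 z)) ^ 2 ∂(p 0 N) = ∫ z, (F N z) ^ 2 ∂(p 0 N) :=
        integral_congr_ae ((comp_flow_zero_ae_eq (Φ N) (F N)).mono fun z hz => by
          have hz' : F N ((Φ N).flow 0 z) = F N z := hz
          show F N ((Φ N).flow 0 z) ^ 2 = F N z ^ 2
          rw [hz'])
      have hi1 : Integrable (fun z => 2 * (F N ((Φ N).flow 0 z)) ^ 2) (p 0 N) :=
        (hF00mem N).integrable_sq.const_mul 2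
      have hi2 : Integrable (fun _ : Config (N + 1) (Fin 3) T3 => 2 * c₀ ^ 2) (p 0 N) :=
        integrable_const _
      have hi12 : Integrable (fun z => 2 * (F N ((Φ N).flow 0 z)) ^ 2 + 2 * c₀ ^ 2) (p 0 N) :=
        hi1.add hi2
      calc ∫ z, (F N ((Φ N).flow 0 z) - c₀) ^ 2 ∂(p 0 N)
          ≤ ∫ z, (2 * (F N ((Φ N).flow 0 z)) ^ 2 + 2 * c₀ ^ 2) ∂(p 0 N) :=
            integral_mono (hX2 N) hi12 hpt
        _ = 2 * ∫ z, (F N z) ^ 2 ∂(p 0 N) + 2 * c₀ ^ 2 := by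
            rw [integral_add hi1 hi2, integral_const_mul, integral_const, hF002]
            simp
        _ ≤ _ := by nlinarith [hF2le N]
    have hX := tendsto_integral_of_tendsto_measure (μ := fun N => p 0 N) hXm hX2 hB h0
    -- back to the means
    have hsplit : ∀ N, ∫ z, F N ((Φ N).flow 0 z) ∂(p 0 N) =
        (∫ z, (F N ((Φ N).flow 0 z) - c₀) ∂(p 0 N)) + c₀ := by
      intro N
      have h1 : Integrable (fun z => F N ((Φ N).flow 0 z)) (p 0 N) := (hF00mem N).integrable one_le_two
      have h2 : Integrable (fun _ : Config (N + 1) (Fin 3) T3 => c₀) (p 0 N) := integrable_const c₀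
      rw [integral_sub h1 h2, integral_const]
      simp
    simp_rw [hsplit, hc0]
    simpa using hX.add_const c₀
  -- (5)–(6) variance and `L²` membership at `κ = 1`
  have hmem : ∀ N, MemLp (fun z => F N ((Φ N).flow t z)) 2 (p 1 N) := fun N => hFmem 1 h11 N
  have hvar : Tendsto (fun N => variance (fun z => F N ((Φ N).flow t z)) (p 1 N)) atTop (𝓝 0) := by
    refine tendsto_of_tendsto_of_tendsto_of_le_of_le tendsto_const_nhds ?_
      (fun N => variance_nonneg _ _) (fun N => hvarle N (hmem N))
    simpa using hV.const_mul C
  -- conclusion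
  exact tendsto_lintegral_ofReal_sq_sub (p := p) (F := fun N z => F N ((Φ N).flow t z)) (c := c)
    (hprob 1 h11) hderiv hcont hunif' hc hanchor hvar hmem

end Summit.AtomisticToContinuum.HydrodynamicLimit.Theorems.OneSphereInfluenceMeanVarianceL2

end
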